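import Summits.Ventures.PercRepro.RankDistBookLevels

/-!
# PercRepro — THE BOTTOM-CUMULATIVE INEQUALITY (BC): the repaired row, closed under direct sums
unconditionally, true on every book (p9, gen 23)

The row (SC) `s_q·C(n,u) ≤ s_u·C(n,q)` is false (`RankDistBookSum`). What the direct-sum closure of g22 really
needs of a factor is an inequality at EVERY level `q ≤ v ≤ p` INCLUDING the ends, and with the bottom family
`𝓑 = PerFlat.Uq M p q` on the left the ends are THEOREMS: `#𝓑 ≤ s_q` (`card_Uq_le_card_shadowLev`) and
`#𝓑 ≤ s_p` (`card_Uq_le_card_shadowLev_top`). So define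
**(BC) `BottomCumulativeTop M p q`: `#𝓑·C(n,v) ≤ s_v·C(n,q)` for every `q ≤ v ≤ p`** (`n = p + q`). Then
* `rls_of_bottomCumulativeTop` — (BC) implies C-025 `ThmN.RLS M p q` (`#U ≤ #𝓑`, `s_v ≤ c_v`);
* `bottomCumulativeTop_of_shadowCumulativeTop` — (SC) with TOP implies (BC) (so (BC) holds on every family where (SC)
  was proved: paving, series-degenerate, uniform, their direct sums);
* `card_Uq_disjointSum` — `#𝓑(M ⊕ N) = #𝓑(M)·#𝓑(N)` on tight layers;
* `bottomCumulativeTop_disjointSum` — **(BC) IS CLOSED UNDER DIRECT SUMS, UNCONDITIONALLY** (the restricted Vandermonde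
  inequality `card_winFam_mul_choose_ge` and the convolution `card_shadowLev_disjointSum`, as in g22, with `#𝓑` in
  place of `s_q`);
* `bottomCumulativeTop_book` — every book `B_k` satisfies (BC) (its tight layer has the two levels `k, k + 1` only,
  both ends), although TOP fails on it for `k ≥ 6`.
So (BC) is the natural candidate in place of C-048: it is a strengthening of the crux C-025 on the tight layer,
census-true where (SC) was (g19's «weak `#𝓑`-form»), unrefuted by the books and their sums, and reduces to
connected cells without any side condition. Recorded, not claimed. Nothing here moves any window of the crux.
-/

namespace PercRepro.RankDist

open Set Finset _root_.Matroid PercRepro.ThmH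

variable {α : Type} [DecidableEq α] (M : Matroid α) [M.Finite]

/-- **(BC), the bottom-cumulative inequality with both ends**: `#𝓑·C(p+q, v) ≤ s_v·C(p+q, q)` for every
`q ≤ v ≤ p`. -/
def BottomCumulativeTop (p q : ℕ) : Prop :=
  ∀ v, q ≤ v → v ≤ p →
    (PerFlat.Uq M p q).card * (p + q).choose v ≤ (shadowLev M v (PerFlat.Uq M p q)).card * (p + q).choose q

/-- (SC) with TOP implies (BC): `#𝓑 ≤ s_q`. -/
theorem bottomCumulativeTop_of_shadowCumulativeTop (p q : ℕ) (h : ShadowCumulativeTop M p q) :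
    BottomCumulativeTop M p q :=
  fun v hqv hvp => (Nat.mul_le_mul_right _ (card_Uq_le_card_shadowLev M p q)).trans (h v hqv hvp)

/-- **C-025 FROM (BC)**: `ThmN.RLS M p q`. -/
theorem rls_of_bottomCumulativeTop (p q : ℕ) (hcum : BottomCumulativeTop M p q) : ThmN.RLS M p q := by
  unfold ThmN.RLS phiK
  have hU := PerFlat.ncard_U_le_card_Uq M p q
  rw [ncard_Y_eq_sum M p q]
  have hpos : (0 : ℚ) < ((p + q).choose p : ℚ) := by
    exact_mod_cast Nat.choose_pos (by omega)
  rw [div_mul_eq_mul_div, div_le_iff₀ hpos]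
  have key : (∑ u ∈ Ioo q p, (p + q).choose u)
      * {A : Set α | A ⊆ M.E ∧ M.eRk A = (p : ℕ∞) ∧ M.eRk (M.E \ A) = (q : ℕ∞)}.ncard
      ≤ (∑ u ∈ Ioo q p, levelCount M u) * (p + q).choose p := by
    calc (∑ u ∈ Ioo q p, (p + q).choose u)
          * {A : Set α | A ⊆ M.E ∧ M.eRk A = (p : ℕ∞) ∧ M.eRk (M.E \ A) = (q : ℕ∞)}.ncard
        ≤ (∑ u ∈ Ioo q p, (p + q).choose u) * (PerFlat.Uq M p q).card := Nat.mul_le_mul_left _ hU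
      _ = ∑ u ∈ Ioo q p, (PerFlat.Uq M p q).card * (p + q).choose u := by
          rw [Finset.sum_mul]; exact Finset.sum_congr rfl fun u _ => mul_comm _ _
      _ ≤ ∑ u ∈ Ioo q p, (shadowLev M u (PerFlat.Uq M p q)).card * (p + q).choose q := by
          refine Finset.sum_le_sum fun u hu => ?_
          rw [Finset.mem_Ioo] at hu
          exact hcum u hu.1.le hu.2.le
      _ ≤ ∑ u ∈ Ioo q p, levelCount M u * (p + q).choose q := by
          refine Finset.sum_le_sum fun u _ => ?_
          exact Nat.mul_le_mul_right _ (card_shadowLev_le_levelCount M u _)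
      _ = (∑ u ∈ Ioo q p, levelCount M u) * (p + q).choose p := by
          rw [Finset.sum_mul, Nat.choose_symm_add]
  exact_mod_cast key

/-! ## The bottom sets of a direct sum are the pairs -/

/-- **`#𝓑(M ⊕ N) = #𝓑(M) · #𝓑(N)`** on tight layers: a bottom set of the sum is the union of one bottom set of each
factor. -/
theorem card_Uq_disjointSum (N : Matroid α) [N.Finite] (h : Disjoint M.E N.E)
    [hS : (M.disjointSum N h).Finite] {p₁ q₁ p₂ q₂ : ℕ} (hn₁ : (gr M).card = p₁ + q₁)
    (hr₁ : M.eRank = (p₁ : ℕ∞)) (hn₂ : (gr N).card = p₂ + q₂) (hr₂ : N.eRank = (p₂ : ℕ∞)) :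
    (PerFlat.Uq (M.disjointSum N h) (p₁ + p₂) (q₁ + q₂)).card
      = (PerFlat.Uq M p₁ q₁).card * (PerFlat.Uq N p₂ q₂).card := by
  have hgrM : (gr M : Set α) = M.E := coe_gr M
  have hgrN : (gr N : Set α) = N.E := coe_gr N
  have hgrdisj : Disjoint (gr M) (gr N) := by
    rw [← Finset.disjoint_coe, hgrM, hgrN]
    exact h
  rw [← Finset.card_product]
  refine Finset.card_nbij' (fun B => (B ∩ gr M, B ∩ gr N)) (fun x => x.1 ∪ x.2) ?_ ?_ ?_ ?_
  · intro B hB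
    rw [Finset.mem_coe, mem_Uq_disjointSum M N h hn₁ hr₁ hn₂ hr₂] at hB
    rw [Finset.mem_coe, Finset.mem_product]
    exact ⟨hB.2.1, hB.2.2⟩
  · intro x hx
    rw [Finset.mem_coe, Finset.mem_product] at hx
    have h1 : x.1 ⊆ gr M := (PerFlat.mem_Uq.1 hx.1).1
    have h2 : x.2 ⊆ gr N := (PerFlat.mem_Uq.1 hx.2).1
    rw [Finset.mem_coe, mem_Uq_disjointSum M N h hn₁ hr₁ hn₂ hr₂]
    refine ⟨Finset.union_subset_union h1 h2, ?_, ?_⟩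
    · have e : (x.1 ∪ x.2) ∩ gr M = x.1 := by
        rw [Finset.union_inter_distrib_right, Finset.inter_eq_left.2 h1,
          Finset.disjoint_iff_inter_eq_empty.1 (hgrdisj.symm.mono_left h2), Finset.union_empty]
      rw [e]; exact hx.1
    · have e : (x.1 ∪ x.2) ∩ gr N = x.2 := by
        rw [Finset.union_inter_distrib_right, Finset.inter_eq_left.2 h2,
          Finset.disjoint_iff_inter_eq_empty.1 (hgrdisj.mono_left h1), Finset.empty_union]
      rw [e]; exact hx.2
  · intro B hB
    rw [Finset.mem_coe, mem_Uq_disjointSum M N h hn₁ hr₁ hn₂ hr₂] at hB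
    show B ∩ gr M ∪ B ∩ gr N = B
    rw [← Finset.inter_union_distrib_left, Finset.inter_eq_left.2 hB.1]
  · intro x hx
    rw [Finset.mem_coe, Finset.mem_product] at hx
    have h1 : x.1 ⊆ gr M := (PerFlat.mem_Uq.1 hx.1).1
    have h2 : x.2 ⊆ gr N := (PerFlat.mem_Uq.1 hx.2).1
    show ((x.1 ∪ x.2) ∩ gr M, (x.1 ∪ x.2) ∩ gr N) = x
    have e1 : (x.1 ∪ x.2) ∩ gr M = x.1 := by
      rw [Finset.union_inter_distrib_right, Finset.inter_eq_left.2 h1,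
        Finset.disjoint_iff_inter_eq_empty.1 (hgrdisj.symm.mono_left h2), Finset.union_empty]
    have e2 : (x.1 ∪ x.2) ∩ gr N = x.2 := by
      rw [Finset.union_inter_distrib_right, Finset.inter_eq_left.2 h2,
        Finset.disjoint_iff_inter_eq_empty.1 (hgrdisj.mono_left h1), Finset.empty_union]
    rw [e1, e2]

/-! ## (BC) is closed under direct sums -/

/-- **(BC) IS CLOSED UNDER DIRECT SUMS, UNCONDITIONALLY**: tight layers `(p₁, q₁)`, `(p₂, q₂)` with `q_i ≤ p_i`; if
both factors satisfy (BC), so does the sum at `(p₁ + p₂, q₁ + q₂)`. -/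
theorem bottomCumulativeTop_disjointSum (N : Matroid α) [N.Finite] (h : Disjoint M.E N.E)
    [hS : (M.disjointSum N h).Finite] {p₁ q₁ p₂ q₂ : ℕ} (hn₁ : (gr M).card = p₁ + q₁)
    (hr₁ : M.eRank = (p₁ : ℕ∞)) (hn₂ : (gr N).card = p₂ + q₂) (hr₂ : N.eRank = (p₂ : ℕ∞))
    (hq₁ : q₁ ≤ p₁) (hq₂ : q₂ ≤ p₂) (hM : BottomCumulativeTop M p₁ q₁) (hN : BottomCumulativeTop N p₂ q₂) :
    BottomCumulativeTop (M.disjointSum N h) (p₁ + p₂) (q₁ + q₂) := by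
  intro u hqu hup
  have hgrM : (gr M : Set α) = M.E := coe_gr M
  have hgrN : (gr N : Set α) = N.E := coe_gr N
  have hgrdisj : Disjoint (gr M) (gr N) := by
    rw [← Finset.disjoint_coe, hgrM, hgrN]
    exact h
  have hn : (gr M ∪ gr N).card = p₁ + p₂ + (q₁ + q₂) := by
    rw [Finset.card_union_of_disjoint hgrdisj, hn₁, hn₂]
    ring
  set W := Finset.Icc (max q₁ (u - p₂)) (min p₁ (u - q₂)) with hW
  have hWsub : W ⊆ Finset.range (u + 1) := by
    intro v hv
    rw [hW, Finset.mem_Icc, max_le_iff, le_min_iff] at hv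
    rw [Finset.mem_range]
    omega
  have hconv := card_shadowLev_disjointSum M N h hn₁ hr₁ hn₂ hr₂ u
  have hbot := card_Uq_disjointSum M N h hn₁ hr₁ hn₂ hr₂
  have h1 : ∑ v ∈ W, (shadowLev M v (PerFlat.Uq M p₁ q₁)).card * (shadowLev N (u - v) (PerFlat.Uq N p₂ q₂)).card
      ≤ (shadowLev (M.disjointSum N h) u (PerFlat.Uq (M.disjointSum N h) (p₁ + p₂) (q₁ + q₂))).card := by
    rw [hconv]
    exact Finset.sum_le_sum_of_subset_of_nonneg hWsub (fun _ _ _ => Nat.zero_le _)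
  have h2 : ∀ v ∈ W,
      (PerFlat.Uq M p₁ q₁).card * (PerFlat.Uq N p₂ q₂).card
          * ((gr M).card.choose v * (gr N).card.choose (u - v))
        ≤ (shadowLev M v (PerFlat.Uq M p₁ q₁)).card * (shadowLev N (u - v) (PerFlat.Uq N p₂ q₂)).card
          * ((gr M).card.choose q₁ * (gr N).card.choose q₂) := by
    intro v hv
    rw [hW, Finset.mem_Icc, max_le_iff, le_min_iff] at hv
    have hMv := hM v (by omega) (by omega)
    have hNv := hN (u - v) (by omega) (by omega)
    rw [← hn₁] at hMv
    rw [← hn₂] at hNv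
    calc (PerFlat.Uq M p₁ q₁).card * (PerFlat.Uq N p₂ q₂).card
          * ((gr M).card.choose v * (gr N).card.choose (u - v))
        = ((PerFlat.Uq M p₁ q₁).card * (gr M).card.choose v)
          * ((PerFlat.Uq N p₂ q₂).card * (gr N).card.choose (u - v)) := by ring
      _ ≤ ((shadowLev M v (PerFlat.Uq M p₁ q₁)).card * (gr M).card.choose q₁)
          * ((shadowLev N (u - v) (PerFlat.Uq N p₂ q₂)).card * (gr N).card.choose q₂) :=
          Nat.mul_le_mul hMv hNv
      _ = _ := by ring
  have h3 : (PerFlat.Uq M p₁ q₁).card * (PerFlat.Uq N p₂ q₂).card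
        * (winFam (gr M) (gr N) q₁ p₁ q₂ p₂ u).card
      ≤ (∑ v ∈ W, (shadowLev M v (PerFlat.Uq M p₁ q₁)).card * (shadowLev N (u - v) (PerFlat.Uq N p₂ q₂)).card)
        * ((gr M).card.choose q₁ * (gr N).card.choose q₂) := by
    rw [card_winFam_eq_sum hgrdisj hqu, ← hW, Finset.mul_sum, Finset.sum_mul]
    exact Finset.sum_le_sum h2
  have h4 := card_winFam_mul_choose_ge hgrdisj hn₁ hn₂ hq₁ hq₂ hqu hup
  rw [hn] at h4
  have hpos : 0 < (gr M).card.choose q₁ * (gr N).card.choose q₂ :=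
    Nat.mul_pos (Nat.choose_pos (by omega)) (Nat.choose_pos (by omega))
  rw [hbot]
  refine Nat.le_of_mul_le_mul_right ?_ hpos
  calc (PerFlat.Uq M p₁ q₁).card * (PerFlat.Uq N p₂ q₂).card
        * (p₁ + p₂ + (q₁ + q₂)).choose u * ((gr M).card.choose q₁ * (gr N).card.choose q₂)
      = (PerFlat.Uq M p₁ q₁).card * (PerFlat.Uq N p₂ q₂).card
        * ((gr M).card.choose q₁ * (gr N).card.choose q₂ * (p₁ + p₂ + (q₁ + q₂)).choose u) := by ring
    _ ≤ (PerFlat.Uq M p₁ q₁).card * (PerFlat.Uq N p₂ q₂).card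
        * ((winFam (gr M) (gr N) q₁ p₁ q₂ p₂ u).card * (p₁ + p₂ + (q₁ + q₂)).choose (q₁ + q₂)) :=
        Nat.mul_le_mul_left _ h4
    _ = ((PerFlat.Uq M p₁ q₁).card * (PerFlat.Uq N p₂ q₂).card
        * (winFam (gr M) (gr N) q₁ p₁ q₂ p₂ u).card) * (p₁ + p₂ + (q₁ + q₂)).choose (q₁ + q₂) := by ring
    _ ≤ ((∑ v ∈ W, (shadowLev M v (PerFlat.Uq M p₁ q₁)).card * (shadowLev N (u - v) (PerFlat.Uq N p₂ q₂)).card)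
        * ((gr M).card.choose q₁ * (gr N).card.choose q₂)) * (p₁ + p₂ + (q₁ + q₂)).choose (q₁ + q₂) :=
        Nat.mul_le_mul_right _ h3
    _ ≤ ((shadowLev (M.disjointSum N h) u (PerFlat.Uq (M.disjointSum N h) (p₁ + p₂) (q₁ + q₂))).card
        * ((gr M).card.choose q₁ * (gr N).card.choose q₂)) * (p₁ + p₂ + (q₁ + q₂)).choose (q₁ + q₂) :=
        Nat.mul_le_mul_right _ (Nat.mul_le_mul_right _ h1)
    _ = _ := by ring

/-- **C-025 for a direct sum of (BC) cells.** -/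
theorem rls_disjointSum_of_bottomCumulativeTop (N : Matroid α) [N.Finite] (h : Disjoint M.E N.E)
    [hS : (M.disjointSum N h).Finite] {p₁ q₁ p₂ q₂ : ℕ} (hn₁ : (gr M).card = p₁ + q₁)
    (hr₁ : M.eRank = (p₁ : ℕ∞)) (hn₂ : (gr N).card = p₂ + q₂) (hr₂ : N.eRank = (p₂ : ℕ∞))
    (hq₁ : q₁ ≤ p₁) (hq₂ : q₂ ≤ p₂) (hM : BottomCumulativeTop M p₁ q₁) (hN : BottomCumulativeTop N p₂ q₂) :
    ThmN.RLS (M.disjointSum N h) (p₁ + p₂) (q₁ + q₂) :=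
  rls_of_bottomCumulativeTop _ _ _ (bottomCumulativeTop_disjointSum M N h hn₁ hr₁ hn₂ hr₂ hq₁ hq₂ hM hN)

/-! ## Every book satisfies (BC) -/

/-- **Every book `B_k` satisfies (BC)**: its tight layer `(k + 1, k)` has the two levels `k` and `k + 1` only, and
both ends are theorems (`#𝓑 ≤ s_q`, `#𝓑 ≤ s_p`). -/
theorem bottomCumulativeTop_book {k : ℕ} (f : Option (Fin k × Bool) → α) (hf : Function.Injective f) :
    BottomCumulativeTop (book f hf) (k + 1) k := by
  intro v hqv hvp
  rcases Nat.eq_or_lt_of_le hqv with heq | hlt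
  · rw [← heq]
    exact Nat.mul_le_mul_right _ (card_Uq_le_card_shadowLev _ _ _)
  · have hv : v = k + 1 := by omega
    rw [hv, Nat.choose_symm_add]
    exact Nat.mul_le_mul_right _ (card_Uq_le_card_shadowLev_top _ (card_gr_book f hf) (eRank_book f hf))

end PercRepro.RankDist
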